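import Summits.Ventures.Crystal3D.Theorems.StickyWulffConstantGenericWallFloorExactOnly
import HarnessLib

/-!
# Transport of the E2 vocabulary under rigid motions (crux `GenericWallFloor`, line `WallLedgerG`)

HONEST FRAMING. Part of the venture `Summits/Ventures/Crystal3D` (cell `crystal3d-full`), helper
`--supports` the crux `GenericWallFloor` (stmt-Ventures-19480) of `route-Ventures-StickyWulffConstant`,
registered line `WallLedgerG`, open stub `stub_twoSlabAdhesion` — general-filling step, per-ball programme
E1/E2 (cf-p1 ROUTE.md §80).  The E1 certification campaign (eng) proves `ExactOnly 0 O` for own patterns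
`O ⊆ fccKissingPattern / hcpKissingPattern` in the CUBIC frame at the ORIGIN; the coverage flow (E3) uses
it at a ball `u` of a grain with frame `A`.  This file is the glue: the E2 predicates of
`…GenericWallFloorExactOnly` are invariant under rigid motions `x ↦ L x + t`
(`IsKissingAround.image`, `IsClosePackedDozenAt.image`, **`ExactOnly.image`**, **`SingleDozen.image`**).

WHAT THIS IS NOT: no certificate; not the stub; rung F-C1 not moved.
-/

noncomputable section

namespace Summit.Ventures.Crystal3D.Theorems

open Literature.Geometry.DiscreteGeometry

/-! ### Rigid motions `x ↦ L x + t` -/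

/-- A rigid motion is injective. -/
theorem rigidMotion_injective (L : EuclideanSpace ℝ (Fin 3) ≃ₗᵢ[ℝ] EuclideanSpace ℝ (Fin 3))
    (t : EuclideanSpace ℝ (Fin 3)) : Function.Injective fun x : EuclideanSpace ℝ (Fin 3) => L x + t :=
  fun _ _ h => L.injective (add_right_cancel h)

/-- A rigid motion preserves distances. -/
theorem dist_rigidMotion (L : EuclideanSpace ℝ (Fin 3) ≃ₗᵢ[ℝ] EuclideanSpace ℝ (Fin 3))
    (t x y : EuclideanSpace ℝ (Fin 3)) : dist (L x + t) (L y + t) = dist x y := by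
  rw [dist_add_right, L.dist_map]

/-- Kissing arrangements are transported by rigid motions. -/
theorem IsKissingAround.image (L : EuclideanSpace ℝ (Fin 3) ≃ₗᵢ[ℝ] EuclideanSpace ℝ (Fin 3))
    (t : EuclideanSpace ℝ (Fin 3)) {c : EuclideanSpace ℝ (Fin 3)} {S : Finset (EuclideanSpace ℝ (Fin 3))}
    (h : IsKissingAround c S) : IsKissingAround (L c + t) (S.image fun x => L x + t) := by
  classical
  refine ⟨fun s hs => ?_, fun s hs s' hs' hne => ?_⟩
  · obtain ⟨x, hx, rfl⟩ := Finset.mem_image.1 hs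
    rw [dist_rigidMotion]; exact h.1 x hx
  · obtain ⟨x, hx, rfl⟩ := Finset.mem_image.1 hs
    obtain ⟨y, hy, rfl⟩ := Finset.mem_image.1 hs'
    have hxy : x ≠ y := fun e => hne (by rw [e])
    rw [dist_rigidMotion]; exact h.2 x hx y hy hxy

/-- Close-packed dozens are transported by rigid motions. -/
theorem IsClosePackedDozenAt.image (L : EuclideanSpace ℝ (Fin 3) ≃ₗᵢ[ℝ] EuclideanSpace ℝ (Fin 3))
    (t : EuclideanSpace ℝ (Fin 3)) {c : EuclideanSpace ℝ (Fin 3)} {D : Finset (EuclideanSpace ℝ (Fin 3))}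
    (h : IsClosePackedDozenAt c D) : IsClosePackedDozenAt (L c + t) (D.image fun x => L x + t) := by
  classical
  obtain ⟨B, hB⟩ := h
  refine ⟨L.toLinearIsometry.comp B, ?_⟩
  have key : ∀ P : Finset (EuclideanSpace ℝ (Fin 3)),
      (↑D : Set (EuclideanSpace ℝ (Fin 3))) = (fun p => B p + c) '' ↑P →
      (↑(D.image fun x => L x + t) : Set (EuclideanSpace ℝ (Fin 3))) =
        (fun p => (L.toLinearIsometry.comp B) p + (L c + t)) '' ↑P := by
    intro P hP
    rw [Finset.coe_image, hP, Set.image_image]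
    refine Set.image_congr fun p _ => ?_
    simp only [LinearIsometry.coe_comp, Function.comp_apply, LinearIsometryEquiv.coe_toLinearIsometry,
      map_add]
    abel
  rcases hB with hB | hB
  · exact Or.inl (key _ hB)
  · exact Or.inr (key _ hB)

/-- The inverse rigid motion. -/
theorem rigidMotion_symm_apply (L : EuclideanSpace ℝ (Fin 3) ≃ₗᵢ[ℝ] EuclideanSpace ℝ (Fin 3))
    (t x : EuclideanSpace ℝ (Fin 3)) : L (L.symm (x - t)) + t = x := by
  rw [LinearIsometryEquiv.apply_symm_apply, sub_add_cancel]

/-- The inverse rigid motion, other composition. -/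
theorem rigidMotion_symm_apply' (L : EuclideanSpace ℝ (Fin 3) ≃ₗᵢ[ℝ] EuclideanSpace ℝ (Fin 3))
    (t x : EuclideanSpace ℝ (Fin 3)) : L.symm (L x + t - t) = x := by
  rw [add_sub_cancel_right, LinearIsometryEquiv.symm_apply_apply]

/-- Image of an image under the inverse motion. -/
theorem image_rigidMotion_symm_image (L : EuclideanSpace ℝ (Fin 3) ≃ₗᵢ[ℝ] EuclideanSpace ℝ (Fin 3))
    (t : EuclideanSpace ℝ (Fin 3)) (S : Finset (EuclideanSpace ℝ (Fin 3))) [DecidableEq (EuclideanSpace ℝ (Fin 3))] :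
    (S.image fun x => L.symm (x - t)).image (fun x => L x + t) = S := by
  rw [Finset.image_image]
  convert Finset.image_id (s := S) using 2
  funext x
  exact rigidMotion_symm_apply L t x

/-- **Exact-only is invariant under rigid motions** (E1 certificates in the cubic frame at the origin
transport to every grain frame and every centre). -/
theorem ExactOnly.image (L : EuclideanSpace ℝ (Fin 3) ≃ₗᵢ[ℝ] EuclideanSpace ℝ (Fin 3))
    (t : EuclideanSpace ℝ (Fin 3)) {c : EuclideanSpace ℝ (Fin 3)} {O : Finset (EuclideanSpace ℝ (Fin 3))}
    (h : ExactOnly c O) : ExactOnly (L c + t) (O.image fun x => L x + t) := by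
  classical
  intro N hON hcard hkiss
  -- pull the completion back to the frame of `c`
  set N' : Finset (EuclideanSpace ℝ (Fin 3)) := N.image fun x => L.symm (x - t) with hN'
  have hsymm_inj : Function.Injective fun x : EuclideanSpace ℝ (Fin 3) => L.symm (x - t) :=
    fun x y hxy => by simpa using congrArg (fun z => L z + t) hxy
  have hc' : L.symm (L c + t - t) = c := rigidMotion_symm_apply' L t c
  have hON' : O ⊆ N' := by
    intro o ho
    have : L o + t ∈ N := hON (Finset.mem_image.2 ⟨o, ho, rfl⟩)
    refine Finset.mem_image.2 ⟨L o + t, this, ?_⟩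
    exact rigidMotion_symm_apply' L t o
  have hcard' : N'.card = 12 := by rw [hN', Finset.card_image_of_injective _ hsymm_inj, hcard]
  have hkiss' : IsKissingAround c N' := by
    have := hkiss.image L.symm (-L.symm t)
    have ec : L.symm (L c + t) + -L.symm t = c := by rw [map_add, LinearIsometryEquiv.symm_apply_apply]; abel
    rw [ec] at this
    convert this using 1
    rw [hN']
    refine Finset.image_congr fun x _ => ?_
    show L.symm (x - t) = L.symm x + -L.symm t
    rw [map_sub]; abel
  have hD := h N' hON' hcard' hkiss'
  have := hD.image L t
  rwa [hN', image_rigidMotion_symm_image] at this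

/-- **Single-dozen-ness is invariant under rigid motions.** -/
theorem SingleDozen.image (L : EuclideanSpace ℝ (Fin 3) ≃ₗᵢ[ℝ] EuclideanSpace ℝ (Fin 3))
    (t : EuclideanSpace ℝ (Fin 3)) {c : EuclideanSpace ℝ (Fin 3)} {slots O : Finset (EuclideanSpace ℝ (Fin 3))}
    (h : SingleDozen c slots O) :
    SingleDozen (L c + t) (slots.image fun x => L x + t) (O.image fun x => L x + t) := by
  classical
  intro D hD hOD
  set D' : Finset (EuclideanSpace ℝ (Fin 3)) := D.image fun x => L.symm (x - t) with hD'
  have hcp' : IsClosePackedDozenAt c D' := by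
    have := hD.image L.symm (-L.symm t)
    have ec : L.symm (L c + t) + -L.symm t = c := by rw [map_add, LinearIsometryEquiv.symm_apply_apply]; abel
    rw [ec] at this
    convert this using 1
    rw [hD']
    refine Finset.image_congr fun x _ => ?_
    show L.symm (x - t) = L.symm x + -L.symm t
    rw [map_sub]; abel
  have hOD' : O ⊆ D' := by
    intro o ho
    have : L o + t ∈ D := hOD (Finset.mem_image.2 ⟨o, ho, rfl⟩)
    exact Finset.mem_image.2 ⟨L o + t, this, rigidMotion_symm_apply' L t o⟩
  have hEq := h D' hcp' hOD'
  -- push forward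
  have : D = D'.image fun x => L x + t := by rw [hD', image_rigidMotion_symm_image]
  rw [this, hEq]

end Summit.Ventures.Crystal3D.Theorems

end
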